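import Summits.BirchSwinnertonDyer.BirchSwinnertonDyer.Theorems.KatoDescentPotSupersingularIntegralH1RankZeroIndex
import Summits.BirchSwinnertonDyer.BirchSwinnertonDyer.Theorems.KatoDescentPotSupersingularZetaBodyRankOneBottomValue
import Summits.BirchSwinnertonDyer.Rank1Residual.GaloisImage.KatoKuriharaValueEmptyLevel
import Literature.NumberTheory.EllipticCurves.Kato2004.MemberHullZetaInputs
import Literature.NumberTheory.EllipticCurves.KatoTwistedFinitenessEulerFactorsProofs
import Literature.NumberTheory.EllipticCurves.KatoTwistedFinitenessTrivialCharacterProofs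
import Literature.NumberTheory.EllipticCurves.CuspFormLFunctionAnalyticRankProofs
import Literature.NumberTheory.EllipticCurves.ModularFormsGamma0Genus
import HarnessLib

/-!
# Kato Thm. 14.5 (2) at the member FROM THE VALUE: the clause `index_ne_zero` of
# `Kato2004.MemberHull{,Zeta}Inputs` (item 19659 / wi-78945, crux M stmt-BirchSwinnertonDyer-19196
# `ReducibleKatoMember`) is a THEOREM of the `ZetaBody` witness as soon as its four-cusp factor
# `R⁻(c,d,a,A)` is non-zero — `L(W,1) ≠ 0` makes the bottom class `proj₀ 𝐲 = z_{0,∅}` non-torsion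

Cell `bsd-potss`, seat `bsd-potss-rkm` generation 10; ROUTE-FREE; `--supports stmt-BirchSwinnertonDyer-19196`.

In the zeta-only package `Kato2004.MemberHullZetaInputs` (p519008) the clause
`index_ne_zero : #(A ⧸ Λ·ι(𝐲̄)) ≠ 0` transcribes Kato Thm. 14.5 (2).  Seat rkm g9 showed
(`IntegralH1RankZero.MemberHullInputs.index_ne_zero_iff_not_isOfFinAddOrder_proj_zero`) that on the pin it is
EQUIVALENT to «`I.proj 0 𝐲` is not of finite order» and not derivable from the other fields AS TYPED (the
non-vanishing of the cusp factor of the chosen `(c,d,a,A)` lives in a docstring).  This file proves the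
arithmetic behind the clause for ANY curve `W` carrying a `ZetaBody` witness (no reduction / image hypothesis):
* §1 `exists_isDepletedTwistedL_one_ne_zero` — `f` the newform of `V`, `L(V,1) ≠ 0`: some entire continuation
  of Kato's `M`-depleted series is `≠ 0` at `1` (`IsNewformOf.hasEntireLFunction`,
  `exists_continuation_changeLevel_of` — the removed Euler factors do not vanish at `s = 1`, Hasse).
* §2 `apply_bottom_ne_zero`, `not_isOfFinAddOrder_bottom` — with `κ ≠ 0`, the (C5) guards `(cd, A) = 1`,
  `dd′ ≡ 1 (A)` and `cuspFactor f true 1 c d a A d′ ≠ 0`: `Λ_{0,∅}(z_{0,∅}) ≠ 0` (value law at the bottom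
  level `KatoValue.zetaBody_value_level_one`: `= 1 ⊗ r₀`, `r₀ = κ·L_{(pA)}(f,1)/Ω⁺_f·R⁻`; `Ω⁺_f > 0`), so
  `z_{0,∅}` is not torsion (`Λ_{0,∅}` is additive into a `ℚ`-vector space).
* §3 `isOfFinAddOrder_bottom_of_proj_zero` — along the PIN `I.proj n 𝐲 = Cor(z_{n+1,∅})`:
  `Cor ∘ Cor = Cor` (`coresLe_comp`) and the Euler-system relation at the `p`-step, which has NO Euler
  factor (`IsEulerSystem.cores_p`; Kato Prop. 8.12, `p ∈ S`), give `Cor(proj₀ 𝐲) = z_{0,∅}`.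
* §4 `IwasawaH2Data.natCard_quotient_span_ne_zero_of_not_isOfFinAddOrder` — rkm g9's rank bookkeeping
  ((R0) `rank_integralH1_layerZero_le_one`; `W(ℚ)`, `Ш(W)[p^∞]` finite) re-homed to the descent package
  `IwasawaH2Data`; §5 HEADLINES `not_isOfFinAddOrder_proj_zero_of_zetaBody`,
  `IwasawaH2Data.natCard_quotient_span_ne_zero_of_zetaBody`, `MemberHullZetaInputs.index_ne_zero_of_value`.

CONSEQUENCE (planner / typer; nothing edited here).  In `exists_memberHullZetaInputs` the witness clause already
displays `κ′ ≠ 0`, `0 < A`, `(c, 6pA) = 1`, `(d, 6pN) = 1`, `ZetaBody …`, `L(W,1) ≠ 0`; adding the ELEMENTARY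
guard `Int.gcd (c*d) A = 1 ∧ ∃ d′, d·d′ ≡ 1 [ZMOD A] ∧ cuspFactor f true (fun _ ↦ 1) c d a A d′ ≠ 0` (Kato's
own admissible choice with `γ_*^+ ≠ 0`, Lemma 13.10 (1)) makes `index_ne_zero` REDUNDANT, as `finite_H`,
`torsionFree_H`, `ι_injective`, `finite_coinvariants_H2` were (p491527, p510488, p517108).  HONEST FRAMING:
nothing is booked; the zeta fact stays a transcription of Kato Thm. 12.5/12.6/13.10/13.14/14.16 (2) at the
member; BSD is not advanced; this calibrates which clauses carry arithmetic beyond the tree.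

References: K. Kato, Astérisque 295 (2004), Thm. 6.6 (1) (p. 163), Prop. 8.12 (p. 186), Thm. 9.7 (p. 189),
Thm. 12.5 (1) (pp. 221–222), Ex. 13.3 (p. 225), Lemma 13.10 (1) (p. 230), Thm. 14.5 (2) (p. 236), §14.14
(14.14.1) (p. 243) [Kato2004Asterisque]; K. Rubin, *Euler Systems* (2000) Def. 2.1.1 [Rubin2000];
J. Cremona, *Algorithms for modular elliptic curves* (1997) §2.8 [CremonaAlgorithms1997]; tree
`Rank1Residual/GaloisImage/KatoKuriharaValueEmptyLevel`, `Literature/…/KatoTwistedFinitenessEulerFactorsProofs`,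
`Theorems/KatoDescentPotSupersingularIntegralH1RankZeroIndex`.
-/

set_option autoImplicit false
set_option linter.dupNamespace false

noncomputable section

open scoped NumberField TensorProduct
open Field IsDedekindDomain CongruenceSubgroup
open Literature.NumberTheory.GaloisRepresentations
open Literature.NumberTheory.EllipticCurves Literature.NumberTheory.EllipticCurves.ModularForms
open Literature.NumberTheory.EllipticCurves.Kato2004
open Literature.NumberTheory.EllipticCurves.Kato2004.EulerSystemValues Rat.HeightOneSpectrum
open Literature.NumberTheory.EllipticCurves.IwasawaAlgebra
open Summit.BirchSwinnertonDyer.Rank1Residual.GaloisImage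

namespace Summit.BirchSwinnertonDyer.BirchSwinnertonDyer.Theorems.MemberIndexOfValue

/-! ## §1 Analytic input: a depleted continuation non-vanishing at `s = 1` -/

section Analytic

variable {V : WeierstrassCurve ℚ} [V.IsElliptic] {N : ℕ} [NeZero N] {f : CuspForm (Gamma0 N) 2}

/-- **A depleted continuation non-vanishing at `1`.**  For `f` the newform of `V` with `L(V,1) ≠ 0` and
`M ≥ 1`, some entire continuation `L` of Kato's `M`-depleted series (shape `IsDepletedTwistedL f 1 M 1 L`) has
`L(1) ≠ 0`: `L = P · L(V,·)`, `P` the product of the removed Euler factors, non-zero at `1`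
(`exists_continuation_changeLevel_of`). [cite: Kato2004Asterisque, §6.2 (p. 161) and §14 Thm. 14.2 (p. 235)] -/
theorem exists_isDepletedTwistedL_one_ne_zero (hf : IsNewformOf V f) (hL1 : V.entireLFunction 1 ≠ 0)
    (M : ℕ) [NeZero M] :
    ∃ L : ℂ → ℂ, IsDepletedTwistedL f 1 M (1 : DirichletCharacter ℂ 1) L ∧ L 1 ≠ 0 := by
  have hV : V.HasEntireLFunction := hf.hasEntireLFunction
  have hL₀ : Differentiable ℂ V.entireLFunction := V.differentiable_entireLFunction hV
  have hL₀s : ∀ s : ℂ, 2 < s.re →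
      V.entireLFunction s = twistedLSeries f (1 : DirichletCharacter ℂ 1) s := by
    intro s hs
    rw [twistedLSeries_one_eq_cuspFormLSeries_of_one, hf.cuspFormLSeries_eq,
      V.entireLFunction_eq_LSeries hV (by linarith)]
  haveI : NeZero (1 * M) := ⟨by rw [one_mul]; exact NeZero.ne M⟩
  obtain ⟨L, hLd, hLs, hL1'⟩ := exists_continuation_changeLevel_of (M := 1 * M) hf (dvd_mul_right 1 M)
    (1 : DirichletCharacter ℂ 1) ⟨V.entireLFunction, hL₀, hL₀s, hL1⟩
  exact ⟨L, ⟨hLd, hLs⟩, hL1'⟩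

end Analytic

/-! ## §2 The bottom value and the bottom class of a `ZetaBody` witness -/

section Value

variable {W : WeierstrassCurve ℚ} [W.IsElliptic] {p : ℕ} [Fact p.Prime]
  [ContinuousSMul ℤ_[p] (W.tateModule p)] [Module.Free ℤ_[p] (W.tateModule p)]
  [Module.Finite ℤ_[p] (W.tateModule p)] {N : ℕ} [NeZero N] {f : CuspForm (Gamma0 N) 2}
  {ι : (m : ℕ) → (CyclotomicField m ℚ →+* ℂ)} {κ : ℝ}
  {Λ : ∀ (k : ℕ) (r : Finset (HeightOneSpectrum (𝓞 ℚ))),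
    H1 (tateRep W p) (cycSubgroup p k r) →ₗ[ℤ_[p]] ℚ_[p] ⊗[ℚ] CyclotomicField (cycLevel p k r) ℚ}
  {c d a : ℤ} {A : ℕ}
  {z : ∀ (k : ℕ) (r : (cyclotomicLevelsRat p (badPlaces c d A N)).Ideals),
    H1 (tateRep W p) ((cyclotomicLevelsRat p (badPlaces c d A N)).level k r.1)}
  {x : ∀ (k : ℕ) (r : (cyclotomicLevelsRat p (badPlaces c d A N)).Ideals),
    CyclotomicField (cycLevel p k r.1) ℚ}
  {V : WeierstrassCurve ℚ} [V.IsElliptic]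

/-- **The bottom value of a `ZetaBody` witness is non-zero** when `κ ≠ 0`, `f` is the newform of a curve `V`
with `L(V,1) ≠ 0` (member fact: `V = W` the original curve, the classes living on the isogenous member), the
(C5) guards `(cd, A) = 1`, `dd′ ≡ 1 (A)` hold and `R⁻(c,d,a,A;d′) ≠ 0`: `Λ_{0,∅}(z_{0,∅}) ≠ 0` (value law at the
bottom level `KatoValue.zetaBody_value_level_one`, §1, `Ω⁺_f > 0`).
[cite: Kato2004Asterisque, Thm. 9.7 (p. 189), Thm. 6.6 (1) (p. 163), Thm. 12.5 (1) (pp. 221–222)] [cite: CremonaAlgorithms1997, §2.8] -/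
theorem apply_bottom_ne_zero (hbody : ZetaBody W p f ι κ Λ c d a A z x) (hκ : κ ≠ 0)
    (hf : IsNewformOf V f) (hL1 : V.entireLFunction 1 ≠ 0) (hA : 0 < A) (d' : ℤ)
    (hcd : Int.gcd (c * d) A = 1) (hdd' : d * d' ≡ 1 [ZMOD (A : ℤ)])
    (hR : cuspFactor f true (fun _ ↦ 1) c d a A d' ≠ 0) :
    Λ 0 (cyclotomicLevelsRat p (badPlaces c d A N)).idealOne.1
        (z 0 (cyclotomicLevelsRat p (badPlaces c d A N)).idealOne) ≠ 0 := by
  haveI : NeZero A := ⟨hA.ne'⟩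
  haveI : NeZero (p * A) := ⟨mul_ne_zero (Fact.out : p.Prime).ne_zero (NeZero.ne A)⟩
  obtain ⟨L, hL, hL1'⟩ := exists_isDepletedTwistedL_one_ne_zero hf hL1 (p * A)
  have hL' : IsDepletedTwistedL f (cycLevel p 0 ∅) (p * A)
      (1 : DirichletCharacter ℂ (cycLevel p 0 ∅)) L :=
    ZetaBodyScaling.isDepletedTwistedL_one_of_eq (KatoValue.cycLevel_zero_empty p) hL
  obtain ⟨r₀, -, hΛ, hr₀⟩ := KatoValue.zetaBody_value_level_one hbody d' hcd hdd' hL'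
  have hΩ : (plusPeriod f : ℂ) ≠ 0 :=
    Complex.ofReal_ne_zero.mpr (IsNewform0.plusPeriod_pos_holds hf.1 hf.coeffField_eq_bot).ne'
  have hr₀ne : r₀ ≠ 0 := by
    intro h
    rw [h, Rat.cast_zero] at hr₀
    rcases mul_eq_zero.mp hr₀.symm with h1 | h1
    · rcases mul_eq_zero.mp h1 with h2 | h2
      · exact hκ (Complex.ofReal_eq_zero.mp h2)
      · exact div_ne_zero hL1' hΩ h2
    · exact hR h1
  rw [hΛ]
  intro h0
  apply hr₀ne
  have hinj := Algebra.TensorProduct.includeRight_injective (R := ℚ) (A := ℚ_[p])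
    (B := CyclotomicField (cycLevel p 0 (cyclotomicLevelsRat p (badPlaces c d A N)).idealOne.1) ℚ)
    (algebraMap ℚ ℚ_[p]).injective
  have h1 : algebraMap ℚ
      (CyclotomicField (cycLevel p 0 (cyclotomicLevelsRat p (badPlaces c d A N)).idealOne.1) ℚ) r₀ = 0 :=
    hinj (by
      rw [Algebra.TensorProduct.includeRight_apply, Algebra.TensorProduct.includeRight_apply,
        TensorProduct.tmul_zero]
      exact h0)
  exact (map_eq_zero_iff _ (algebraMap ℚ _).injective).mp h1

/-- **The bottom class `z_{0,∅}` of such a witness is not torsion**: `Λ_{0,∅}` is additive into a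
`ℚ`-vector space and does not vanish on it. [cite: Kato2004Asterisque, Thm. 14.5 (2) (p. 236) and Thm. 12.5 (1) (p. 221)] -/
theorem not_isOfFinAddOrder_bottom (hbody : ZetaBody W p f ι κ Λ c d a A z x) (hκ : κ ≠ 0)
    (hf : IsNewformOf V f) (hL1 : V.entireLFunction 1 ≠ 0) (hA : 0 < A) (d' : ℤ)
    (hcd : Int.gcd (c * d) A = 1) (hdd' : d * d' ≡ 1 [ZMOD (A : ℤ)])
    (hR : cuspFactor f true (fun _ ↦ 1) c d a A d' ≠ 0) :
    ¬ IsOfFinAddOrder (z 0 (cyclotomicLevelsRat p (badPlaces c d A N)).idealOne) := by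
  intro hfin
  apply apply_bottom_ne_zero hbody hκ hf hL1 hA d' hcd hdd' hR
  set v := Λ 0 (cyclotomicLevelsRat p (badPlaces c d A N)).idealOne.1
    (z 0 (cyclotomicLevelsRat p (badPlaces c d A N)).idealOne) with hv
  -- the image of a torsion class under the additive map `Λ_{0,∅}` is torsion …
  have hv' : IsOfFinAddOrder v :=
    (Λ 0 (cyclotomicLevelsRat p (badPlaces c d A N)).idealOne.1).toAddMonoidHom.isOfFinAddOrder hfin
  -- … and a torsion element of a `ℚ`-vector space is zero
  obtain ⟨n, hn, h⟩ := hv'.exists_nsmul_eq_zero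
  have hn0 : (n : ℚ) ≠ 0 := Nat.cast_ne_zero.mpr hn.ne'
  calc v = ((n : ℚ)⁻¹ * (n : ℚ)) • v := by rw [inv_mul_cancel₀ hn0, one_smul]
    _ = (n : ℚ)⁻¹ • (n • v) := by rw [mul_smul, Nat.cast_smul_eq_nsmul]
    _ = 0 := by rw [h, smul_zero]

end Value

/-! ## §3 Along the pin: `Cor(proj₀ 𝐲) = z_{0,∅}` -/

section Pin

variable {W : WeierstrassCurve ℚ} [W.IsElliptic] {p : ℕ} [Fact p.Prime]
  [ContinuousSMul ℤ_[p] (W.tateModule p)] [Module.Free ℤ_[p] (W.tateModule p)]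
  [Module.Finite ℤ_[p] (W.tateModule p)]
  {κ : ZpExtension ℚ p} (hκ : κ.IsCyclotomic) (hp : p ≠ 2) {γ : absoluteGaloisGroup ℚ}
  (I : IwasawaH1Data W p κ γ)

omit [W.IsElliptic] [ContinuousSMul ℤ_[p] (W.tateModule p)] [Module.Free ℤ_[p] (W.tateModule p)]
  [Module.Finite ℤ_[p] (W.tateModule p)] in
/-- The bottom layer of the `ℤ_p`-tower lies in the bottom Euler-system level: `Gal(ℚ̄/ℚ_0) ≤ Gal(ℚ̄/ℚ(μ_1)) = Γ_ℚ`
(`EulerSystemLevels.level_bot_empty`). [cite: Rubin2000, Def. 2.1.1 and Remark 2.1.4] -/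
theorem layerSubgroup_zero_le_level_zero (S : Set (HeightOneSpectrum (𝓞 ℚ))) :
    κ.layerSubgroup 0 ≤ (cyclotomicLevelsRat p S).level 0 ∅ := by
  have h : (cyclotomicLevelsRat p S).level ⊥ ∅ = ⊤ := (cyclotomicLevelsRat p S).level_bot_empty
  rw [show (⊥ : ℕ) = 0 from rfl] at h
  rw [h]
  exact le_top

/-- **`proj₀ 𝐲` torsion ⇒ `z_{0,∅}` torsion** along the pin `I.proj 0 𝐲 = Cor_{ℚ(μ_p)/ℚ}(z_{1,∅})` of an Euler
system on the levels of `cyclotomicLevelsRat p S` (`p` odd, `κ` cyclotomic): `coresLe_comp` along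
`Gal(ℚ̄/ℚ_0) ≤ Gal(ℚ̄/ℚ(μ_1))` and the `p`-step norm relation (`IsEulerSystem.cores_p`, no Euler factor) give
`Cor(proj₀ 𝐲) = z_{0,∅}`. [cite: Kato2004Asterisque, Prop. 8.12 (p. 186) and §13.1 (p. 224)] [cite: Rubin2000, Def. 2.1.1] -/
theorem isOfFinAddOrder_bottom_of_proj_zero (S : Set (HeightOneSpectrum (𝓞 ℚ)))
    (zf : ∀ (k : ℕ) (r : (cyclotomicLevelsRat p S).Ideals),
      H1 (tateRep W p) ((cyclotomicLevelsRat p S).level k r.1))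
    (hz : IsEulerSystem (cyclotomicLevelsRat p S) (tateRep W p) p zf) (y : I.H)
    (hy : I.proj 0 y = levelToLayer W p hκ hp S 0 (zf 1 (cyclotomicLevelsRat p S).idealOne))
    (hfin : IsOfFinAddOrder (I.proj 0 y)) :
    IsOfFinAddOrder (zf 0 (cyclotomicLevelsRat p S).idealOne) := by
  -- finite-index instances
  haveI : ((cyclotomicLevelsRat p S).level 1 ∅).FiniteIndex :=
    finiteIndex_of_isOpen_of_compactSpace _ ((cyclotomicLevelsRat p S).isOpen_level 1 ∅)
  haveI : (κ.layerSubgroup 0).FiniteIndex :=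
    finiteIndex_of_isOpen_of_compactSpace _ (κ.isOpen_layerSubgroup 0)
  -- `letI`: the instances must unfold to the `Fintype.ofFinite _` inside `levelToLayer` / `coresP`
  letI : Fintype (κ.layerSubgroup 0 ⧸
      ((cyclotomicLevelsRat p S).level 1 ∅).subgroupOf (κ.layerSubgroup 0)) := Fintype.ofFinite _
  letI : Fintype ((cyclotomicLevelsRat p S).level 0 ∅ ⧸
      (κ.layerSubgroup 0).subgroupOf ((cyclotomicLevelsRat p S).level 0 ∅)) := Fintype.ofFinite _
  letI : Fintype ((cyclotomicLevelsRat p S).level 0 ∅ ⧸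
      ((cyclotomicLevelsRat p S).level 1 ∅).subgroupOf ((cyclotomicLevelsRat p S).level 0 ∅)) :=
    Fintype.ofFinite _
  have h₁ : (cyclotomicLevelsRat p S).level 1 ∅ ≤ κ.layerSubgroup 0 :=
    hκ.cyclotomicLevelsRat_level_succ_le_layerSubgroup hp S 0
  have h₂ : κ.layerSubgroup 0 ≤ (cyclotomicLevelsRat p S).level 0 ∅ :=
    layerSubgroup_zero_le_level_zero (κ := κ) S
  have hV := (cyclotomicLevelsRat p S).isOpen_level 1 ∅
  have r := LinearMap.congr_fun  -- `Cor_{layer 0→level 0} ∘ Cor_{level 1→layer 0} = Cor_{level 1→level 0}`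
    (coresLe_comp (tateRep W p).toTopRep h₁ h₂ hV (κ.isOpen_layerSubgroup 0))
    (zf 1 (cyclotomicLevelsRat p S).idealOne)
  rw [LinearMap.comp_apply] at r
  have hes := hz.cores_p (zero_le_one) (cyclotomicLevelsRat p S).idealOne  -- the `p`-step relation
  have key : coresLe (tateRep W p).toTopRep h₂ (κ.isOpen_layerSubgroup 0) (I.proj 0 y) =
      zf 0 (cyclotomicLevelsRat p S).idealOne := by
    rw [hy, ← hes]
    unfold levelToLayer EulerSystemLevels.coresP
    exact r
  rw [← key]
  exact (coresLe (tateRep W p).toTopRep h₂ (κ.isOpen_layerSubgroup 0)).toAddMonoidHom.isOfFinAddOrder hfin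

end Pin

/-! ## §4 The index clause -/

section Index

variable {W : WeierstrassCurve ℚ} [W.IsElliptic] {p : ℕ} [Fact p.Prime]
  [ContinuousSMul ℤ_[p] (W.tateModule p)] {κ : ZpExtension ℚ p} {γ : absoluteGaloisGroup ℚ}
  {I : IwasawaH1Data W p κ γ}

/-- Under the pin of a descent package, `Λ · ι(𝐲̄) ⊆ A` is `ℤ_p · proj₀ 𝐲 ⊆ H¹(ℤ[1/p], T_pW)` (rkm g9's
`MemberHullInputs.map_span_eq_span_projZero`, on the `(A, toH1, ι)`-fields of `IwasawaH2Data`).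
[cite: Kato2004Asterisque, §14.14 (14.14.1) (p. 243)] -/
theorem IwasawaH2Data.map_span_eq_span_projZero (D : IwasawaH2Data W p κ γ I) (y : I.H)
    (e : D.A ≃+ integralH1 (tateRep W p) p (κ.layerSubgroup 0))
    (he : ∀ a : D.A, (e a : H1 (tateRep W p) (κ.layerSubgroup 0)) = D.toH1 a) :
    ((IwasawaAlgebra p) ∙ D.ι (Submodule.Quotient.mk y)).toAddSubgroup.map (e : D.A →+ _) =
      ((ℤ_[p]) ∙ (⟨I.proj 0 y, I.proj_mem 0 y⟩ :
        integralH1 (tateRep W p) p (κ.layerSubgroup 0))).toAddSubgroup := by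
  ext x
  simp only [AddSubgroup.mem_map, Submodule.mem_toAddSubgroup, Submodule.mem_span_singleton,
    AddMonoidHom.coe_coe]
  constructor
  · rintro ⟨a, ⟨g, rfl⟩, rfl⟩
    refine ⟨PowerSeries.constantCoeff g, Subtype.ext ?_⟩
    rw [Submodule.coe_smul, he, D.toH1_smul, D.toH1_ι]
  · rintro ⟨c, rfl⟩
    refine ⟨(PowerSeries.C c : IwasawaAlgebra p) • D.ι (Submodule.Quotient.mk y), ⟨PowerSeries.C c, rfl⟩,
      Subtype.ext ?_⟩
    rw [he, D.toH1_smul, D.toH1_ι, PowerSeries.constantCoeff_C, Submodule.coe_smul]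

/-- The pin of `A` as an additive isomorphism `A ≃+ H¹(ℤ[1/p], T_pW)` on a descent package.
[cite: Kato2004Asterisque, §8.2 and Lemma 8.5 (pp. 180–184)] -/
theorem IwasawaH2Data.exists_addEquiv_integralH1 (D : IwasawaH2Data W p κ γ I) :
    ∃ e : D.A ≃+ integralH1 (tateRep W p) p (κ.layerSubgroup 0),
      ∀ a : D.A, (e a : H1 (tateRep W p) (κ.layerSubgroup 0)) = D.toH1 a := by
  have hmem : ∀ a : D.A, D.toH1 a ∈ integralH1 (tateRep W p) p (κ.layerSubgroup 0) := fun a =>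
    (D.mem_range_toH1_iff _).mp ⟨a, rfl⟩
  let f : D.A →+ integralH1 (tateRep W p) p (κ.layerSubgroup 0) :=
    D.toH1.codRestrict (integralH1 (tateRep W p) p (κ.layerSubgroup 0)).toAddSubgroup hmem
  have hf : Function.Bijective f := by
    refine ⟨fun a b h => D.toH1_injective (by simpa [f] using congrArg Subtype.val h), fun x => ?_⟩
    obtain ⟨a, ha⟩ := (D.mem_range_toH1_iff (x : H1 (tateRep W p) (κ.layerSubgroup 0))).mpr x.2
    exact ⟨a, Subtype.ext ha⟩
  exact ⟨AddEquiv.ofBijective f hf, fun _ => rfl⟩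

/-- **`proj₀ 𝐲` of infinite order ⟹ `#(A ⧸ Λ·ι(𝐲̄)) ≠ 0`** on a descent package `IwasawaH2Data` with `W(ℚ)`
and `Ш(W)[p^∞]` finite — (R0) `rank_{ℤ_p} H¹(ℤ[1/p],T_pW) ≤ 1` (`rank_integralH1_layerZero_le_one`) and rank
bookkeeping over `ℤ_p` (rkm g9, re-homed from `MemberHullInputs`). [cite: Kato2004Asterisque, Thm. 14.5 (1)(2) (p. 236)] -/
theorem IwasawaH2Data.natCard_quotient_span_ne_zero_of_not_isOfFinAddOrder (D : IwasawaH2Data W p κ γ I)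
    [Finite W.toAffine.Point] [Finite (AddCommGroup.primaryComponent W.sha p)] {y : I.H}
    (hy : ¬ IsOfFinAddOrder (I.proj 0 y)) :
    Nat.card (D.A ⧸ (IwasawaAlgebra p) ∙ D.ι (Submodule.Quotient.mk y)) ≠ 0 := by
  obtain ⟨e, he⟩ := IwasawaH2Data.exists_addEquiv_integralH1 D
  haveI := module_finite_integralH1_layerZero W p κ
  set y₀ : integralH1 (tateRep W p) p (κ.layerSubgroup 0) := ⟨I.proj 0 y, I.proj_mem 0 y⟩ with hy₀
  have hy₀' : ¬ IsOfFinAddOrder y₀ := by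
    intro hfin
    apply hy
    obtain ⟨n, hn, hny⟩ := hfin.exists_nsmul_eq_zero
    exact isOfFinAddOrder_iff_nsmul_eq_zero.mpr ⟨n, hn, by simpa [hy₀] using congrArg Subtype.val hny⟩
  have hfin : Finite (integralH1 (tateRep W p) p (κ.layerSubgroup 0) ⧸ (ℤ_[p]) ∙ y₀) :=
    IntegralH1RankZero.finite_quotient_of_rank_le_one p
      (IntegralH1RankZero.rank_integralH1_layerZero_le_one W p κ) _
      (Submodule.mem_span_singleton_self y₀) hy₀'
  have eq : (D.A ⧸ (IwasawaAlgebra p) ∙ D.ι (Submodule.Quotient.mk y)) ≃+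
      (integralH1 (tateRep W p) p (κ.layerSubgroup 0) ⧸ (ℤ_[p]) ∙ y₀) :=
    QuotientAddGroup.congr ((IwasawaAlgebra p) ∙ D.ι (Submodule.Quotient.mk y)).toAddSubgroup
      ((ℤ_[p]) ∙ y₀).toAddSubgroup e (IwasawaH2Data.map_span_eq_span_projZero D y e he)
  haveI : Finite (D.A ⧸ (IwasawaAlgebra p) ∙ D.ι (Submodule.Quotient.mk y)) :=
    Finite.of_equiv _ eq.symm.toEquiv
  exact Nat.card_pos.ne'

end Index

/-! ## §5 Headline: Thm. 14.5 (2) at the member from the value -/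

section Headline

variable {W : WeierstrassCurve ℚ} [W.IsElliptic] {p : ℕ} [Fact p.Prime]
  [ContinuousSMul ℤ_[p] (W.tateModule p)] [Module.Free ℤ_[p] (W.tateModule p)]
  [Module.Finite ℤ_[p] (W.tateModule p)] {N : ℕ} [NeZero N] {f : CuspForm (Gamma0 N) 2}
  {ι : (m : ℕ) → (CyclotomicField m ℚ →+* ℂ)} {κ' : ℝ}
  {Λ : ∀ (k : ℕ) (r : Finset (HeightOneSpectrum (𝓞 ℚ))),
    H1 (tateRep W p) (cycSubgroup p k r) →ₗ[ℤ_[p]] ℚ_[p] ⊗[ℚ] CyclotomicField (cycLevel p k r) ℚ}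
  {c d a : ℤ} {A : ℕ}
  {z : ∀ (k : ℕ) (r : (cyclotomicLevelsRat p (badPlaces c d A N)).Ideals),
    H1 (tateRep W p) ((cyclotomicLevelsRat p (badPlaces c d A N)).level k r.1)}
  {x : ∀ (k : ℕ) (r : (cyclotomicLevelsRat p (badPlaces c d A N)).Ideals),
    CyclotomicField (cycLevel p k r.1) ℚ}
  {V : WeierstrassCurve ℚ} [V.IsElliptic]
  {κ : ZpExtension ℚ p} {γ : absoluteGaloisGroup ℚ} {I : IwasawaH1Data W p κ γ} {y : I.H}

/-- **`proj₀ 𝐲` is NOT torsion** for the `Λ`-adic lift `𝐲` of a `ZetaBody` witness (pin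
`I.proj n 𝐲 = Cor(z_{n+1,∅})`, `p` odd, `κ` cyclotomic) with `κ′ ≠ 0`, `f` the newform of a curve `V` with
`L(V,1) ≠ 0`, the (C5) guards and a non-zero four-cusp factor.  (§2 + §3.)
[cite: Kato2004Asterisque, Thm. 14.5 (2) (p. 236), Thm. 12.5 (1) (p. 221), Prop. 8.12 (p. 186)] -/
theorem not_isOfFinAddOrder_proj_zero_of_zetaBody (hκ : κ.IsCyclotomic) (hp : p ≠ 2)
    (hbody : ZetaBody W p f ι κ' Λ c d a A z x) (hκ' : κ' ≠ 0)
    (hf : IsNewformOf V f) (hL1 : V.entireLFunction 1 ≠ 0) (hA : 0 < A) (d' : ℤ)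
    (hcd : Int.gcd (c * d) A = 1) (hdd' : d * d' ≡ 1 [ZMOD (A : ℤ)])
    (hR : cuspFactor f true (fun _ ↦ 1) c d a A d' ≠ 0)
    (hy : ∀ n : ℕ, I.proj n y = levelToLayer W p hκ hp (badPlaces c d A N) n
      (z (n + 1) (cyclotomicLevelsRat p (badPlaces c d A N)).idealOne)) :
    ¬ IsOfFinAddOrder (I.proj 0 y) :=
  fun hfin => not_isOfFinAddOrder_bottom hbody hκ' hf hL1 hA d' hcd hdd' hR
    (isOfFinAddOrder_bottom_of_proj_zero hκ hp I (badPlaces c d A N) z hbody.1 y (hy 0) hfin)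

/-- **HEADLINE — Kato Thm. 14.5 (2) at the member from the value.**  On ANY descent package
`D : IwasawaH2Data W p κ γ I` over a pin carrying the lift `𝐲` of a `ZetaBody` witness as above, with `W(ℚ)`
and `Ш(W)[p^∞]` finite: `#(D.A ⧸ Λ·D.ι(𝐲̄)) ≠ 0` — the index of `Λ·ι(𝐲̄)` in `A = H¹(ℤ[1/p],T_pW)` is finite.
[cite: Kato2004Asterisque, Thm. 14.5 (1)(2) (p. 236), Thm. 12.5 (1) (p. 221), §14.14 (14.14.1) (p. 243)] -/
theorem IwasawaH2Data.natCard_quotient_span_ne_zero_of_zetaBody (D : IwasawaH2Data W p κ γ I)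
    [Finite W.toAffine.Point] [Finite (AddCommGroup.primaryComponent W.sha p)]
    (hκ : κ.IsCyclotomic) (hp : p ≠ 2)
    (hbody : ZetaBody W p f ι κ' Λ c d a A z x) (hκ' : κ' ≠ 0)
    (hf : IsNewformOf V f) (hL1 : V.entireLFunction 1 ≠ 0) (hA : 0 < A) (d' : ℤ)
    (hcd : Int.gcd (c * d) A = 1) (hdd' : d * d' ≡ 1 [ZMOD (A : ℤ)])
    (hR : cuspFactor f true (fun _ ↦ 1) c d a A d' ≠ 0)
    (hy : ∀ n : ℕ, I.proj n y = levelToLayer W p hκ hp (badPlaces c d A N) n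
      (z (n + 1) (cyclotomicLevelsRat p (badPlaces c d A N)).idealOne)) :
    Nat.card (D.A ⧸ (IwasawaAlgebra p) ∙ D.ι (Submodule.Quotient.mk y)) ≠ 0 :=
  IwasawaH2Data.natCard_quotient_span_ne_zero_of_not_isOfFinAddOrder D
    (not_isOfFinAddOrder_proj_zero_of_zetaBody hκ hp hbody hκ' hf hL1 hA d' hcd hdd' hR hy)

/-- **The clause `index_ne_zero` of the zeta-only package re-derived WITHOUT using it**: for
`Z : MemberHullZetaInputs W p κ γ I 𝐲` over the lift of a `ZetaBody` witness as above (`W(ℚ)`, `Ш(W)[p^∞]`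
finite), `#(Z.A ⧸ Λ·Z.ι(𝐲̄)) ≠ 0`, via `Z.toIwasawaH2Data`; a re-type adding the elementary witness guard
`(cd, A) = 1 ∧ ∃ d′, dd′ ≡ 1 (A) ∧ cuspFactor f true 1 c d a A d′ ≠ 0` may DROP `index_ne_zero`.
[cite: Kato2004Asterisque, Thm. 14.5 (2) (p. 236) and Lemma 13.10 (1) (p. 230)] -/
theorem MemberHullZetaInputs.index_ne_zero_of_value (Z : MemberHullZetaInputs W p κ γ I y)
    [Finite W.toAffine.Point] [Finite (AddCommGroup.primaryComponent W.sha p)]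
    (hκ : κ.IsCyclotomic) (hγ : κ.IsTopGenerator γ) (hp : p ≠ 2)
    (hbody : ZetaBody W p f ι κ' Λ c d a A z x) (hκ' : κ' ≠ 0)
    (hf : IsNewformOf V f) (hL1 : V.entireLFunction 1 ≠ 0) (hA : 0 < A) (d' : ℤ)
    (hcd : Int.gcd (c * d) A = 1) (hdd' : d * d' ≡ 1 [ZMOD (A : ℤ)])
    (hR : cuspFactor f true (fun _ ↦ 1) c d a A d' ≠ 0)
    (hy : ∀ n : ℕ, I.proj n y = levelToLayer W p hκ hp (badPlaces c d A N) n
      (z (n + 1) (cyclotomicLevelsRat p (badPlaces c d A N)).idealOne)) :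
    Nat.card (Z.A ⧸ (IwasawaAlgebra p) ∙ Z.ι (Submodule.Quotient.mk y)) ≠ 0 :=
  IwasawaH2Data.natCard_quotient_span_ne_zero_of_zetaBody (Z.toIwasawaH2Data hκ hγ) hκ hp hbody hκ' hf hL1
    hA d' hcd hdd' hR hy

end Headline

end Summit.BirchSwinnertonDyer.BirchSwinnertonDyer.Theorems.MemberIndexOfValue

end
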